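import Mathlib.RingTheory.MvPolynomial.Basic
import Mathlib.Algebra.MvPolynomial.CommRing
import Mathlib.RingTheory.Ideal.Span
import Mathlib.RingTheory.Ideal.Maximal
import Mathlib.RingTheory.Localization.Away.Basic
import Mathlib.RingTheory.Polynomial.Basic
import Literature.RingTheory.MvPolynomial.VariableIdeals
import Summits.ResolutionOfSingularities.ResolutionOfSingularities.Theorems.FrobeniusLadderFInjectiveMacaulayficationStrictTransformChartN
import HarnessLib

/-!
# Primality transfer along a chart substitution

Support file for crux stmt-ResolutionOfSingularities-15315
(`FrobeniusLadder.FInjectiveMacaulayfication`, line `Sketch`, §13 THE THREEFOLD CALIBRATION):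
stub `stub_primeTransfer`.

Let `S = k[X₀, …, X_{n-1}]` over a field (or a domain) `k`, fix `i`, write `X = X i`, and let
`θ : S → S` be the chart substitution of the point blow-up, `X i ↦ X i`, `X j ↦ X j · X i`
(`j ≠ i`), constants fixed. If `θ f = X ^ μ · g` with `X ∤ f` and `X ∤ g`, then
**`(f)` is prime iff `(g)` is prime** — so ONE primality computation serves a hypersurface and
all its strict transforms.

Proof layout (elementary; no factoriality is used). Clearing denominators — every `h` has
`X ^ N · h = θ H` for some `N, H` — and `ψ ∘ θ = (S → S[1/X])` for `ψ : X i ↦ X i`,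
`X j ↦ X j / X i` are `StrictTransformChartN.exists_pow_mul_eq` / `.comp_eq` (imported).
* `injective` — `S → S[1/X]` is injective (`X` is regular), so `θ` is injective;
* `prime_X` — `X` is a prime element (`(X i)` is the kernel of `X i ↦ 0` onto a domain,
  `Literature.RingTheory.MvPolynomial.VariableIdeals`); `dvd_of_dvd_X_pow_mul` — if `X ∤ p` and
  `p ∣ X ^ N a` then `p ∣ a`;
* `dvd_of_map_mul_eq` — the transfer step: `θ f · c = X ^ N · θ a` forces `f ∣ a` (clear the
  denominators of `c`, use injectivity, cancel the powers of `X`);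
* `prime_of_prime_transform` (`g` prime ⇒ `f` prime) and `prime_transform_of_prime`
  (`f` prime ⇒ `g` prime), assembled in `stub_primeTransfer` through
  `Ideal.span_singleton_prime`.

Remark on the hypotheses. They are `f ∉ (X i)` and `g ∉ (X i)` (i.e. `X i ∤ f`, `X i ∤ g`), NOT
`X i ∉ (f)`, `X i ∉ (g)`: with the latter the statement fails in both directions
(`n = 2`, `i = 0`: `f = X₀X₁`, `g = X₁`, `μ = 2`, and `f = X₁`, `g = X₀X₁`, `μ = 0`). Under
primality the two conditions agree (`X_not_mem_span_of_isPrime`).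

References: folklore (strict transforms of hypersurfaces under point blow-ups, e.g. J. Kollár,
*Lectures on Resolution of Singularities*, §2.5; The Stacks Project, Tag 080C).
-/

-- single-problem summit: the doubled namespace component is forced
set_option linter.dupNamespace false

noncomputable section

namespace Summit.ResolutionOfSingularities.ResolutionOfSingularities.Theorems.FInjectiveMacaulayfication.PrimeTransfer

open MvPolynomial

section Substitution

variable {k : Type*} [CommRing k] {n : ℕ} {i : Fin n}
  (θ : MvPolynomial (Fin n) k →+* MvPolynomial (Fin n) k)

/-- **The chart substitution is injective**: `ψ ∘ θ` is the localisation map `S → S[1/X i]`,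
which is injective because `X i` is a regular element. [folklore] -/
theorem injective (hθC : ∀ c : k, θ (C c) = C c) (hθi : θ (X i) = X i)
    (hθj : ∀ j : Fin n, j ≠ i → θ (X j) = X j * X i) : Function.Injective θ := by
  classical
  -- the substitution `ψ : X i ↦ X i, X j ↦ X j / X i, c ↦ c`
  let ψ : MvPolynomial (Fin n) k →+* Localization.Away (X i : MvPolynomial (Fin n) k) :=
    MvPolynomial.eval₂Hom ((algebraMap (MvPolynomial (Fin n) k)
      (Localization.Away (X i : MvPolynomial (Fin n) k))).comp MvPolynomial.C)
      fun j => if j = i then algebraMap (MvPolynomial (Fin n) k)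
          (Localization.Away (X i : MvPolynomial (Fin n) k)) (X i)
        else algebraMap (MvPolynomial (Fin n) k)
          (Localization.Away (X i : MvPolynomial (Fin n) k)) (X j) *
            IsLocalization.Away.invSelf (X i : MvPolynomial (Fin n) k)
  have hψC : ∀ c, ψ (C c) = algebraMap (MvPolynomial (Fin n) k)
      (Localization.Away (X i : MvPolynomial (Fin n) k)) (C c) := fun c =>
    MvPolynomial.eval₂Hom_C _ _ c
  have hψi : ψ (X i) = algebraMap (MvPolynomial (Fin n) k)
      (Localization.Away (X i : MvPolynomial (Fin n) k)) (X i) := by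
    simp [ψ]
  have hψj : ∀ j, j ≠ i → ψ (X j) = algebraMap (MvPolynomial (Fin n) k)
      (Localization.Away (X i : MvPolynomial (Fin n) k)) (X j) *
        IsLocalization.Away.invSelf (X i : MvPolynomial (Fin n) k) := by
    intro j hj
    simp [ψ, hj]
  -- `ψ ∘ θ = (S → S[1/X i]) ∘ id`
  have hcomp := StrictTransformChartN.comp_eq (RingHom.id (MvPolynomial (Fin n) k)) X ψ
    (fun _ => rfl) hψC hψi hψj θ hθC hθi hθj
  have hinj : Function.Injective (algebraMap (MvPolynomial (Fin n) k)
      (Localization.Away (X i : MvPolynomial (Fin n) k))) :=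
    IsLocalization.injective (Localization.Away (X i : MvPolynomial (Fin n) k))
      (M := Submonoid.powers (X i : MvPolynomial (Fin n) k))
      (Submonoid.powers_le.2 (MvPolynomial.isRegular_X).mem_nonZeroDivisors)
  intro a b hab
  apply hinj
  have ha := RingHom.congr_fun hcomp a
  have hb := RingHom.congr_fun hcomp b
  rw [RingHom.comp_apply, RingHom.comp_apply, RingHom.id_apply] at ha hb
  rw [← ha, ← hb, hab]

end Substitution

section Domain

variable {k : Type*} [CommRing k] [IsDomain k] {n : ℕ} {i : Fin n}

/-- **`X i` is a prime element of `k[X₀, …, X_{n-1}]`** for a domain `k` (the ideal `(X i)` is the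
kernel of `X i ↦ 0` onto a domain). [folklore] -/
theorem prime_X (i : Fin n) : Prime (X i : MvPolynomial (Fin n) k) := by
  have h := Literature.RingTheory.MvPolynomial.isPrime_span_X_image (R := k) ({i} : Set (Fin n))
  rw [Set.image_singleton] at h
  exact (Ideal.span_singleton_prime (X_ne_zero i)).mp h

/-- **Cancelling powers of `X i`**: if `X i ∤ p` and `p ∣ X i ^ N · a` then `p ∣ a`. [folklore] -/
theorem dvd_of_dvd_X_pow_mul {p a : MvPolynomial (Fin n) k}
    (hp : p ∉ Ideal.span {(X i : MvPolynomial (Fin n) k)}) {N : ℕ} (h : p ∣ X i ^ N * a) :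
    p ∣ a := by
  obtain ⟨c, hc⟩ := h
  have hXp : ¬ X i ∣ p := fun hd => hp (Ideal.mem_span_singleton.mpr hd)
  have hc' : X i ^ N ∣ p * c := ⟨a, by rw [← hc]⟩
  obtain ⟨c', rfl⟩ := (prime_X i).pow_dvd_of_dvd_mul_left N hXp hc'
  refine ⟨c', mul_left_cancel₀ (pow_ne_zero N (X_ne_zero i)) ?_⟩
  rw [hc]
  ring

/-- `X i ∉ (g)` for `(g)` prime with `X i ∤ g` (under primality the two ways of saying
"`X i` does not divide" agree). [folklore] -/
theorem X_not_mem_span_of_isPrime {g : MvPolynomial (Fin n) k} (hg : (Ideal.span {g}).IsPrime)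
    (hgX : g ∉ Ideal.span {(X i : MvPolynomial (Fin n) k)}) :
    (X i : MvPolynomial (Fin n) k) ∉ Ideal.span {g} := by
  intro h
  obtain ⟨c, hc⟩ := Ideal.mem_span_singleton.mp h
  have hXg : ¬ X i ∣ g := fun hd => hgX (Ideal.mem_span_singleton.mpr hd)
  have hdvd : X i ∣ g * c := ⟨1, by rw [mul_one]; exact hc.symm⟩
  rcases (prime_X i).dvd_or_dvd hdvd with hd | ⟨c', rfl⟩
  · exact hXg hd
  · refine hg.ne_top (Ideal.eq_top_of_isUnit_mem _ (Ideal.mem_span_singleton_self g)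
      (IsUnit.of_mul_eq_one c' (mul_left_cancel₀ (X_ne_zero i) ?_)))
    rw [mul_one]
    conv_rhs => rw [hc]
    ring

variable (θ : MvPolynomial (Fin n) k →+* MvPolynomial (Fin n) k)

/-- **The transfer step**: if `θ f · c = X i ^ N · θ a` and `X i ∤ f`, then `f ∣ a` — clear the
denominators of `c` (`X i ^ M c = θ C'`), so `θ (X i ^ (M + N) a) = θ (f C')`, use the
injectivity of `θ` and cancel the powers of `X i`. [folklore] -/
theorem dvd_of_map_mul_eq (hθC : ∀ c : k, θ (C c) = C c) (hθi : θ (X i) = X i)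
    (hθj : ∀ j : Fin n, j ≠ i → θ (X j) = X j * X i) {f : MvPolynomial (Fin n) k}
    (hf : f ∉ Ideal.span {(X i : MvPolynomial (Fin n) k)}) {a c : MvPolynomial (Fin n) k}
    {N : ℕ} (h : θ f * c = X i ^ N * θ a) : f ∣ a := by
  obtain ⟨M, C', hC'⟩ := StrictTransformChartN.exists_pow_mul_eq θ hθC hθi hθj c
  have h1 : θ (X i ^ (M + N) * a) = θ (f * C') := by
    rw [map_mul, map_mul, map_pow, hθi, ← hC', pow_add, mul_assoc, ← h]
    ring
  exact dvd_of_dvd_X_pow_mul hf ⟨C', injective θ hθC hθi hθj h1⟩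

/-- **`g` prime ⇒ `f` prime** (`θ f = X i ^ μ g`, `X i ∤ f`): `f ∣ a b` gives `g ∣ θ a · θ b`, say
`θ a = g c`, so `θ f · c = X i ^ μ θ a` and the transfer step yields `f ∣ a`. [folklore] -/
theorem prime_of_prime_transform (hθC : ∀ c : k, θ (C c) = C c) (hθi : θ (X i) = X i)
    (hθj : ∀ j : Fin n, j ≠ i → θ (X j) = X j * X i) {f g : MvPolynomial (Fin n) k} {μ : ℕ}
    (hθf : θ f = X i ^ μ * g) (hf : f ∉ Ideal.span {(X i : MvPolynomial (Fin n) k)})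
    (hg : Prime g) : Prime f := by
  refine ⟨?_, ?_, ?_⟩
  · rintro rfl
    exact hf (Ideal.zero_mem _)
  · intro hu
    have h1 : IsUnit (θ f) := hu.map θ
    rw [hθf] at h1
    exact hg.not_unit (isUnit_of_mul_isUnit_right h1)
  · intro a b hab
    have h1 : g ∣ θ a * θ b := by
      have h2 : θ f ∣ θ a * θ b := by
        rw [← map_mul]
        exact map_dvd θ hab
      rw [hθf] at h2
      exact (dvd_mul_left g (X i ^ μ)).trans h2
    rcases hg.dvd_or_dvd h1 with ⟨c, hc⟩ | ⟨c, hc⟩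
    · left
      refine dvd_of_map_mul_eq θ hθC hθi hθj hf (a := a) (c := c) (N := μ) ?_
      rw [hθf, mul_assoc, ← hc]
    · right
      refine dvd_of_map_mul_eq θ hθC hθi hθj hf (a := b) (c := c) (N := μ) ?_
      rw [hθf, mul_assoc, ← hc]

/-- **`f` prime ⇒ `g` prime** (`θ f = X i ^ μ g`, `X i ∤ f`, `X i ∤ g`): if `g ∣ a b`, clear
denominators `X i ^ N₁ a = θ A`, `X i ^ N₂ b = θ B`; then `θ f · (…) = X i ^ μ θ (A B)`, so
`f ∣ A B`, say `A = f A'`, whence `X i ^ N₁ a = X i ^ μ g θ A'` and `g ∣ a`. [folklore] -/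
theorem prime_transform_of_prime (hθC : ∀ c : k, θ (C c) = C c) (hθi : θ (X i) = X i)
    (hθj : ∀ j : Fin n, j ≠ i → θ (X j) = X j * X i) {f g : MvPolynomial (Fin n) k} {μ : ℕ}
    (hθf : θ f = X i ^ μ * g) (hf : f ∉ Ideal.span {(X i : MvPolynomial (Fin n) k)})
    (hg : g ∉ Ideal.span {(X i : MvPolynomial (Fin n) k)}) (hfp : Prime f) : Prime g := by
  refine ⟨?_, ?_, ?_⟩
  · rintro rfl
    exact hg (Ideal.zero_mem _)
  · intro hu
    obtain ⟨u, rfl⟩ := hu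
    have h1 : θ f * ((u⁻¹ : (MvPolynomial (Fin n) k)ˣ) : MvPolynomial (Fin n) k) =
        X i ^ μ * θ 1 := by
      rw [hθf, map_one, mul_one, mul_assoc, Units.mul_inv, mul_one]
    exact hfp.not_unit (isUnit_of_dvd_one (dvd_of_map_mul_eq θ hθC hθi hθj hf h1))
  · intro a b hab
    obtain ⟨q, hq⟩ := hab
    obtain ⟨N₁, A, hA⟩ := StrictTransformChartN.exists_pow_mul_eq θ hθC hθi hθj a
    obtain ⟨N₂, B, hB⟩ := StrictTransformChartN.exists_pow_mul_eq θ hθC hθi hθj b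
    have h1 : θ f * (X i ^ N₁ * X i ^ N₂ * q) = X i ^ μ * θ (A * B) := by
      rw [map_mul, ← hA, ← hB, hθf]
      calc X i ^ μ * g * (X i ^ N₁ * X i ^ N₂ * q)
          = X i ^ μ * X i ^ N₁ * X i ^ N₂ * (g * q) := by ring
        _ = X i ^ μ * X i ^ N₁ * X i ^ N₂ * (a * b) := by rw [hq]
        _ = X i ^ μ * (X i ^ N₁ * a * (X i ^ N₂ * b)) := by ring
    rcases hfp.dvd_or_dvd (dvd_of_map_mul_eq θ hθC hθi hθj hf h1) with ⟨A', hA'⟩ | ⟨B', hB'⟩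
    · left
      refine dvd_of_dvd_X_pow_mul hg (N := N₁) ⟨X i ^ μ * θ A', ?_⟩
      rw [hA, hA', map_mul, hθf]
      ring
    · right
      refine dvd_of_dvd_X_pow_mul hg (N := N₂) ⟨X i ^ μ * θ B', ?_⟩
      rw [hB, hB', map_mul, hθf]
      ring

end Domain

/-- PRIMALITY TRANSFER ALONG A CHART SUBSTITUTION (stub `stub_primeTransfer` of line `Sketch`,
corrected hypotheses): for the chart substitution `θᵢ : X i ↦ X i, X j ↦ X j X i` of
`k[X₀, …, X_{n-1}]`, if `θᵢ f = X i ^ μ · g` with `X i ∤ f` and `X i ∤ g` (i.e. `f, g ∉ (X i)`),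
then `(f)` is prime iff `(g)` is prime (`θᵢ` is injective, every `h` has `X i ^ N h ∈ im θᵢ`,
and `X i` is a prime dividing neither `f` nor `g`). [folklore] -/
theorem stub_primeTransfer : ∀ (k : Type) [Field k] (n : ℕ) (i : Fin n) (f g : MvPolynomial (Fin n) k) (μ : ℕ),
    MvPolynomial.aeval (fun j : Fin n => if j = i then (MvPolynomial.X i : MvPolynomial (Fin n) k)
        else MvPolynomial.X j * MvPolynomial.X i) f = MvPolynomial.X i ^ μ * g →
    f ∉ Ideal.span {(MvPolynomial.X i : MvPolynomial (Fin n) k)} → g ∉ Ideal.span {(MvPolynomial.X i : MvPolynomial (Fin n) k)} →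
    ((Ideal.span {f}).IsPrime ↔ (Ideal.span {g}).IsPrime) := by
  intro k _ n i f g μ hθf hf hg
  have hf0 : f ≠ 0 := by
    rintro rfl
    exact hf (Ideal.zero_mem _)
  have hg0 : g ≠ 0 := by
    rintro rfl
    exact hg (Ideal.zero_mem _)
  rw [Ideal.span_singleton_prime hf0, Ideal.span_singleton_prime hg0]
  let θ : MvPolynomial (Fin n) k →+* MvPolynomial (Fin n) k :=
    (MvPolynomial.aeval fun j : Fin n =>
      if j = i then (X i : MvPolynomial (Fin n) k) else X j * X i).toRingHom
  have hθC : ∀ c : k, θ (C c) = C c := fun c => MvPolynomial.algHom_C _ c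
  have hθi : θ (X i) = X i := (MvPolynomial.aeval_X _ i).trans (if_pos rfl)
  have hθj : ∀ j : Fin n, j ≠ i → θ (X j) = X j * X i := fun j hj =>
    (MvPolynomial.aeval_X _ j).trans (if_neg hj)
  have hθf' : θ f = X i ^ μ * g := hθf
  exact ⟨prime_transform_of_prime θ hθC hθi hθj hθf' hf hg,
    prime_of_prime_transform θ hθC hθi hθj hθf' hf⟩

end Summit.ResolutionOfSingularities.ResolutionOfSingularities.Theorems.FInjectiveMacaulayfication.PrimeTransfer

end
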